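import Summits.QuantumAdvantage.QuantumAdvantage.Theorems.NearExactIsExact.Negative.ReflectedFlatPair

/-!
# `NearExactIsExact` (stmt-QuantumAdvantage-14043) — negative lemma: TRANSPORTED TRANSLATIONS
  (gen 44 disprover; the mechanism behind the reflected-pair certificates, and a census-free kill for the
  two-sided `naff = 4` maps of BQ-11 whose affine transported translation moves a preserved coordinate)

**Setting (DISPROOF.md §46.3, §48.11–48.14, §49).** A cubic pair with `15/16 < Φ < 1` at `n = 22` needs a
biquadratic permutation `π` of `𝔽₂¹¹` (`σ = π⁻¹`, both quadratic) and cubics with `c₁ ⊕ c₂∘π = 1_U`, `U` a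
5-flat.  For a target vector `e` put `τ_e := σ ∘ (· ⊕ e) ∘ π` — the translation by `e` TRANSPORTED to the
source.  `e ↦ τ_e` is a homomorphism (`τ_e ∘ τ_{e'} = τ_{e ⊕ e'}`), every `τ_e` (`e ≠ 0`) is a fixed-point-free
involution, and `E_aff(π) := {e : τ_e is affine}` is a linear subspace of `𝔽₂¹¹` — an invariant of the
biquadratic map (`τ_e` is affine iff the bilinear map `(a,b) ↦ β_σ(e, β_π(a,b))` vanishes, `β` the
polarisations).  If `τ_e` is affine (or merely affine on a 5-flat `S₀ = σ₀(𝔽₂⁵)`), then `S₁ := τ_e(S₀)` is an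
affine 5-flat with `π(S₁) = π(S₀) ⊕ e`, and `reflected_flat_pair` (Negative/ReflectedFlatPair) says
`|S₀ ∩ U| + |S₁ ∩ U|` is even.  Since `S₁ ∩ U = S₀ ∩ τ_e(U)` and `τ_e(U) = σ(π(U) ⊕ e)` is a 5-flat DISJOINT
from `U` when `e ∉ π(U)`, a transversal `S₀` through one point of `U` missing `τ_e(U)` kills the map.

* `transported_translation` — the parity statement (any `n`, any `π` with a right inverse on the reflected
  points, `π` quadratic, `τ_e ∘ σ₀` affine);
* `transported_translation_kill` — plus the two mass facts (`S₀` meets `U` in an odd number of parameters,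
  `τ_e(S₀)` misses `U`) ⇒ `False`;
* `frame_translate_empty` — CENSUS-FREE: source `𝔽₂^{6+5}` (base `u ∈ 𝔽₂⁶`, fibre `t ∈ 𝔽₂⁵`), residual
  `U = [u = 0]`, `π` quadratic and PRESERVING one base coordinate `u_{i₀}` (`π(w)_{i₀} = w_{i₀}`; in the D2
  normal form of the `naff = 4` stratum the four frame coordinates `ū` are preserved), `e` with `e_{i₀} = 1`
  and `τ_e` affine on the coordinate-hyperplane section `S₀ = {(u, 0) : u_{i₀} = 0}` ⇒ NO cubic pair.
  (`S₀ ∩ U = {0}`; every point of `τ_e(S₀)` has `u_{i₀} = 0 ⊕ 1 = 1`, so `τ_e(S₀) ∩ U = ∅`.)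

**Pilot (gen 44, 25 two-sided stratum-(I) maps of the `naff = 4` census N4-CENSUS-1, DISPROOF.md §49;
exact linear algebra over `𝔽₂`, every certificate re-verified pointwise).** `dim E_aff ∈ {3,4,5,6}` (equal
on the two sides), `E_aff ⊄ π(U)` for 23/25; 22/25 maps are instances of `frame_translate_empty` verbatim
(an `e ∈ E_aff` with a non-zero preserved-frame part), 1 is an instance of `transported_translation_kill`
with a twisted-coordinate hyperplane section, and the 2 maps with `E_aff ⊆ π(U)` die by the flat-local form
(`τ_e` affine on a hyperplane, resp. on one transversal 5-flat — `transported_translation` as stated).  The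
full census numbers (kit job of the cell) are recorded in DISPROOF.md §49; they are data ABOUT this lemma,
not used BY it.

HONEST FRAMING: kernel-checked negative lemmas (a parity mechanism + one census-free corollary) about the
last Maiorana–McFarland habitat of `NearExactIsExact`; NOT summit progress — no violation of the crux, no
new per-n value; maps with `E_aff ⊆ π(U)`, the strata `naff ≤ 3`, `naff = 0`, the crux and the summit are
untouched by this file.
-/

set_option linter.dupNamespace false -- D-0017: single-problem summit ⇒ `QuantumAdvantage.QuantumAdvantage` by design

namespace Summit.QuantumAdvantage.QuantumAdvantage.Theorems.NearExactIsExact.Negative.TransportedTranslation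

open Finset
open Literature.Computability.QuantumComplexity
open Literature.Computability.QuantumComplexity.BuzetChailloux (bxor)
open Summit.QuantumAdvantage.QuantumAdvantage.Theorems.CubicForrelation.NearExactIsExact
  (fc_isDegLeFun_comp)
open Summit.QuantumAdvantage.QuantumAdvantage.Theorems.NearExactIsExact.Negative.SkewProductCore
open Summit.QuantumAdvantage.QuantumAdvantage.Theorems.NearExactIsExact.Negative.ReflectedFlatPair
  (reflected_flat_pair)

/-- **TRANSPORTED TRANSLATION (parity).** `c₁ ⊕ c₂∘π = U` with cubic `c₁, c₂`, `π` quadratic with a right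
inverse `σ` (`π (σ z) = z`), `σ₀ : 𝔽₂⁵ → 𝔽₂ⁿ` affine and `τ_e ∘ σ₀ = σ(π(σ₀ ·) ⊕ e)` affine ⇒ the total
`U`-mass of the flat and its transported translate is even. [folklore] -/
theorem transported_translation {n : ℕ} (π σ : (Fin n → Bool) → (Fin n → Bool))
    (hπσ : ∀ z, π (σ z) = z)
    (c₁ c₂ : (Fin n → Bool) → Bool) (h₁ : IsDegLeFun 3 c₁) (h₂ : IsDegLeFun 3 c₂)
    (U : (Fin n → Bool) → Bool) (hres : ∀ z, (c₁ z ^^ c₂ (π z)) = U z)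
    (hπ2 : ∀ j, IsDegLeFun 2 (fun w => π w j)) (e : Fin n → Bool)
    (σ₀ : (Fin 5 → Bool) → (Fin n → Bool)) (hσ₀ : ∀ j, IsDegLeFun 1 (fun v => σ₀ v j))
    (hτ : ∀ j, IsDegLeFun 1 (fun v => σ (bxor (π (σ₀ v)) e) j)) :
    ∑ v, ind (U (σ₀ v)) + ∑ v, ind (U (σ (bxor (π (σ₀ v)) e))) = 0 :=
  reflected_flat_pair π c₁ c₂ h₁ h₂ U hres σ₀ (fun v => σ (bxor (π (σ₀ v)) e)) hσ₀ hτ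
    (fun j => fc_isDegLeFun_comp (hπ2 j) σ₀ hσ₀ (by norm_num)) e (fun v => hπσ _)

/-- A globally affine transported translation is affine on every affine flat. [folklore] -/
theorem affine_comp_affine {n m : ℕ} (τ : (Fin n → Bool) → (Fin n → Bool))
    (hτ : ∀ j, IsDegLeFun 1 (fun w => τ w j))
    (σ₀ : (Fin m → Bool) → (Fin n → Bool)) (hσ₀ : ∀ j, IsDegLeFun 1 (fun v => σ₀ v j)) :
    ∀ j, IsDegLeFun 1 (fun v => τ (σ₀ v) j) :=
  fun j => fc_isDegLeFun_comp (hτ j) σ₀ hσ₀ (by norm_num)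

/-- **TRANSPORTED TRANSLATION (kill).** In the setting of `transported_translation`, if `S₀ = σ₀(𝔽₂⁵)`
carries odd `U`-mass (as a parametrised flat) and its transported translate misses `U`, there is no such
cubic pair. [folklore] -/
theorem transported_translation_kill {n : ℕ} (π σ : (Fin n → Bool) → (Fin n → Bool))
    (hπσ : ∀ z, π (σ z) = z)
    (c₁ c₂ : (Fin n → Bool) → Bool) (h₁ : IsDegLeFun 3 c₁) (h₂ : IsDegLeFun 3 c₂)
    (U : (Fin n → Bool) → Bool) (hres : ∀ z, (c₁ z ^^ c₂ (π z)) = U z)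
    (hπ2 : ∀ j, IsDegLeFun 2 (fun w => π w j)) (e : Fin n → Bool)
    (σ₀ : (Fin 5 → Bool) → (Fin n → Bool)) (hσ₀ : ∀ j, IsDegLeFun 1 (fun v => σ₀ v j))
    (hτ : ∀ j, IsDegLeFun 1 (fun v => σ (bxor (π (σ₀ v)) e) j))
    (h0 : ∑ v, ind (U (σ₀ v)) = 1) (h1 : ∀ v, U (σ (bxor (π (σ₀ v)) e)) = false) : False := by
  have h := transported_translation π σ hπσ c₁ c₂ h₁ h₂ U hres hπ2 e σ₀ hσ₀ hτ
  rw [h0, sum_eq_zero (fun v _ => by rw [h1 v, ind_false]), add_zero] at h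
  exact one_ne_zero h

/-- The inserted base coordinate of the section is `0`. [folklore] -/
theorem hypSection_same (i₀ : Fin 6) (v : Fin 5 → Bool) :
    (Fin.append (Fin.insertNth (α := fun _ => Bool) i₀ false v) (fun _ : Fin 5 => false)) (Fin.castAdd 5 i₀) = false := by
  rw [Fin.append_left]
  exact Fin.insertNth_apply_same (α := fun _ => Bool) i₀ false v

/-- The other base coordinates of the section are the parameters. [folklore] -/
theorem hypSection_succAbove (i₀ : Fin 6) (v : Fin 5 → Bool) (k : Fin 5) :
    (Fin.append (Fin.insertNth (α := fun _ => Bool) i₀ false v) (fun _ : Fin 5 => false)) (Fin.castAdd 5 (i₀.succAbove k)) = v k := by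
  rw [Fin.append_left]
  exact Fin.insertNth_apply_succAbove (α := fun _ => Bool) i₀ false v k

/-- The fibre coordinates of the section are `0`. [folklore] -/
theorem hypSection_fibre (i₀ : Fin 6) (v : Fin 5 → Bool) (k : Fin 5) :
    (Fin.append (Fin.insertNth (α := fun _ => Bool) i₀ false v) (fun _ : Fin 5 => false)) (Fin.natAdd 6 k) = false := by
  rw [Fin.append_right]

/-- The coordinates of the section are affine. [folklore] -/
theorem hypSection_coord_deg (i₀ : Fin 6) :
    ∀ j : Fin (6 + 5), IsDegLeFun 1 (fun v : Fin 5 → Bool => (Fin.append (Fin.insertNth (α := fun _ => Bool) i₀ false v) (fun _ : Fin 5 => false)) j) := by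
  intro j
  induction j using Fin.addCases with
  | left b =>
    induction b using Fin.succAboveCases i₀ with
    | x =>
      have e0 : (fun v : Fin 5 → Bool => (Fin.append (Fin.insertNth (α := fun _ => Bool) i₀ false v) (fun _ : Fin 5 => false)) (Fin.castAdd 5 i₀)) = fun _ => false :=
        funext fun v => hypSection_same i₀ v
      rw [e0]; exact isDegLeFun_const 1 false
    | p k =>
      have ek : (fun v : Fin 5 → Bool => (Fin.append (Fin.insertNth (α := fun _ => Bool) i₀ false v) (fun _ : Fin 5 => false)) (Fin.castAdd 5 (i₀.succAbove k))) =
          fun v => v k := funext fun v => hypSection_succAbove i₀ v k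
      rw [ek]; exact isDegLeFun_apply k le_rfl
  | right k =>
    have ek : (fun v : Fin 5 → Bool => (Fin.append (Fin.insertNth (α := fun _ => Bool) i₀ false v) (fun _ : Fin 5 => false)) (Fin.natAdd 6 k)) = fun _ => false :=
      funext fun v => hypSection_fibre i₀ v k
    rw [ek]; exact isDegLeFun_const 1 false

/-- The section meets `U = [u = 0]` exactly in the parameter `v = 0`. [folklore] -/
theorem hypSection_base_zero_iff (i₀ : Fin 6) (v : Fin 5 → Bool) :
    (∀ b : Fin 6, (Fin.append (Fin.insertNth (α := fun _ => Bool) i₀ false v) (fun _ : Fin 5 => false)) (Fin.castAdd 5 b) = false) ↔ (∀ k : Fin 5, v k = false) := by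
  constructor
  · intro h k
    rw [← hypSection_succAbove i₀ v k]; exact h _
  · intro h b
    induction b using Fin.succAboveCases i₀ with
    | x => exact hypSection_same i₀ v
    | p k => rw [hypSection_succAbove]; exact h k

/-- **FRAME TRANSLATE ⇒ EMPTY (census-free).** Source `𝔽₂^{6+5}`, residual `U = [u = 0]` (all six base
coordinates zero), `π` quadratic with right inverse `σ` and PRESERVING the base coordinate `i₀`
(`π(w)_{i₀} = w_{i₀}`), `e` a target vector with `e_{i₀} = 1` whose transported translation
`τ_e = σ(π(·) ⊕ e)` is affine on the section `S₀ = {(u,0) : u_{i₀} = 0}` (`v ↦ (insertNth i₀ 0 v, 0)`).  Then no cubic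
pair has residual `U`: `S₀ ∩ U = {0}` and `τ_e(S₀)` lies in `{u_{i₀} = 1}`, which misses `U`. [folklore] -/
theorem frame_translate_empty (π σ : (Fin (6 + 5) → Bool) → (Fin (6 + 5) → Bool))
    (hπσ : ∀ z, π (σ z) = z) (i₀ : Fin 6)
    (hframe : ∀ w, π w (Fin.castAdd 5 i₀) = w (Fin.castAdd 5 i₀))
    (c₁ c₂ : (Fin (6 + 5) → Bool) → Bool) (h₁ : IsDegLeFun 3 c₁) (h₂ : IsDegLeFun 3 c₂)
    (hres : ∀ z, (c₁ z ^^ c₂ (π z)) = decide (∀ b : Fin 6, z (Fin.castAdd 5 b) = false))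
    (hπ2 : ∀ j, IsDegLeFun 2 (fun w => π w j)) (e : Fin (6 + 5) → Bool)
    (he : e (Fin.castAdd 5 i₀) = true)
    (hτ : ∀ j, IsDegLeFun 1 (fun v : Fin 5 → Bool => σ (bxor (π ((Fin.append (Fin.insertNth (α := fun _ => Bool) i₀ false v) (fun _ : Fin 5 => false)))) e) j)) :
    False := by
  refine transported_translation_kill π σ hπσ c₁ c₂ h₁ h₂ _ hres hπ2 e (fun v => (Fin.append (Fin.insertNth (α := fun _ => Bool) i₀ false v) (fun _ : Fin 5 => false)))
    (hypSection_coord_deg i₀) hτ ?_ ?_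
  · -- `S₀ ∩ U = {0}`
    simp only [hypSection_base_zero_iff]
    rw [Finset.sum_eq_single (fun _ => false)]
    · simp
    · intro u _ hu
      have hu' : ¬ ∀ k, u k = false := fun h' => hu (funext h')
      simp [hu']
    · intro h'
      exact absurd (mem_univ _) h'
  · -- `τ_e(S₀)` misses `U`: its `i₀`-th base coordinate is `0 ⊕ 1 = 1`
    intro v
    have hσi : ∀ z, σ z (Fin.castAdd 5 i₀) = z (Fin.castAdd 5 i₀) := fun z => by
      have := hframe (σ z); rw [hπσ] at this; exact this.symm
    have hi : σ (bxor (π ((Fin.append (Fin.insertNth (α := fun _ => Bool) i₀ false v) (fun _ : Fin 5 => false)))) e) (Fin.castAdd 5 i₀) = true := by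
      rw [hσi]
      show (π ((Fin.append (Fin.insertNth (α := fun _ => Bool) i₀ false v) (fun _ : Fin 5 => false))) (Fin.castAdd 5 i₀) ^^ e (Fin.castAdd 5 i₀)) = true
      rw [hframe, hypSection_same, he]; rfl
    apply decide_eq_false
    intro h
    have := h i₀
    rw [hi] at this
    exact Bool.noConfusion this

end Summit.QuantumAdvantage.QuantumAdvantage.Theorems.NearExactIsExact.Negative.TransportedTranslation
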